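import Literature.MathematicalPhysics.QuantumFieldTheory.Balaban1983to89.B8Ineq159CurvedCubeMemberUniform

/-!
# `Balaban1983to89.B8Ineq159CurvedCubeMemberDepthUniform` — [Balaban1985RegularSpaces] (1.59) p. 86 «for `U₀ ∈ 𝔄_k({□_j}, α₀)`» on the cube members of ONE
# finite programme: for fixed `(L, M, ρ)` and a DEPTH BOUND `K`, the finitely many shapes `(k, m)`, `1 ≤ m ≤ k ≤ K`, have a common pair of constants — so
# ONE `(α₀, B″)` serves EVERY cube member `(a, η, k ≤ K)` and every truncation (a finite maximum; the constants DEPEND ON `K`)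

statement-level skeleton of published theorems with citation tags; proofs where landed; nothing here is a claim about the
Yang–Mills mass gap

`[Balaban1985RegularSpaces]` ("B8", CMP **99** (1985) 75–102) p. 77 (`𝔄_k({Ω_j}, α₀)`, (1.7)), (1.38) p. 82, (1.59) p. 86, (1.62) p. 87, (1.131) p. 99, p. 99 («□_j ⊂ Ω_j»);
[4] = `[Balaban1985BackgroundPropagators]` Thm 3.3 p. 399 («the constants … depend on d and L only»); [B7] = `[Balaban1985Averaging]` Prop. 2 (52)–(54) p. 26,
(42)–(43) pp. 23–24.

CITATION HEADER (lean-in-tree rule).  Cell `pub-ymgap` (YM Track A, HUMAN RULING D-0062 ∕ D-0149), DAG node N05 = [B8], width seat `pub-ymgap-dag-n05-w3`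
(g3), CLAIM-1 file (W).  WHY.  File (U) of this seat left the per-member constants depending on the SHAPE `(L, M, ρ, k)` and the truncation `m` only.  In one
finite programme `(L, M, ρ)` are fixed and the depth is bounded, `k ≤ K`; the shapes are then FINITELY many, and a finite maximum gives ONE pair of constants
for the whole cube-member family of that programme.  THIS FILE records that bookkeeping consequence — and says loudly what it is not.

THE MATHEMATICS (kernel-checked).  `exists_curved159_perCube_touching_truncations_uniform` (fixed `k`: one pair of constants for all truncations `1 ≤ m ≤ k`,
induction on a truncation bound, `min`∕`max` of two pairs), ★★ `exists_curved159_perCube_touching_depth_uniform` (all `1 ≤ m ≤ k ≤ K`, induction on `K`),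
★★ `exists_curved159_perCube_inAk_sup_unitary_depth_uniform` (unitary C⋆ backgrounds, ANY domain sequence with `□₀ ⊆ Ω₀`, `InAk` form).

HONEST SCOPE ∕ A6 — READ THIS.  The constants of this file DEPEND ON THE DEPTH BOUND `K` (and on `L, M, ρ, d, 𝔸`): they are a finite maximum of the
non-explicit per-shape constants of file (U).  Print's `B₀(d, L)` of [4] Thm 3.3 does NOT depend on the number of renormalisation steps; THIS FILE IS NOT
THAT THEOREM and says nothing uniform in `K` — it is bookkeeping over the finitely many members of ONE finite-`𝕋⁴` programme of depth `≤ K`, useful only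
where a consumer's index family has bounded depth and accepts depth-dependent constants (whether the cell's typed sockets `SockB9P3` ∕ `SockH59` do is a
referee ∕ chair question under the A6 rule, NOT answered here; this file claims no socket).  Only the level-`0` plaquette clause of (1.7) is used;
member-dependent powers of `L` in the derivative targets (file (R) §5).  Non-vacuity: `U₀ = 1`, `φ = 0`.  Count-neutral; N05 NOT discharged; no count claim;
one finite `𝕋⁴` programme at fixed `ε`, Bałaban as printed; the YM mass gap (Clay) is NOT proved by any of this — R4 closes the conditional finite-`𝕋⁴`
rung `BalabanLadder.UV` only; nothing continuum ∕ ℝ⁴ ∕ OS.  No `sorry`, no `def`, no `instance`, no `notation`.  Unit `pub-ymgap-dag-n05-w3` (g3), 2026-08-28.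
-/

noncomputable section

namespace Literature.MathematicalPhysics.QuantumFieldTheory.Balaban1983to89.B8Ineq159CurvedCubeMemberDepthUniform

open B7Prop1Explicit B7Prop2Explicit B7Prop1Local
open B7Prop4GeneralLevels (linCovIter)
open B8Ineq132 (covDerivFwd BondTouches PlaqTouches plaqF InAk)
open B8Eq140Level (SideTouches)
open B8Eq146AExpansion (iEta)
open B8Eq155JBound (Jcur)
open B8Eq138LandauZd (IsLandau138 covLap)
open B8Eq131CubesAdmissible (cubeFam)
open B8CubeMemberZd (cubeLamS)
open B8Ineq159FlatCubeMemberPrinted (cubeLamBP)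
open B8Ineq159CurvedCubeMemberUniform (exists_curved159_perCube_touching_tower_uniform)

-- `Site` alone would resolve to the torus sites of `Setup.lean`; re-export the `ℤ^d` sites of `B7Prop1Explicit`.
export B7Prop1Explicit (Site)

variable {d : ℕ} {𝔸 : Type*} [NormedRing 𝔸] [NormOneClass 𝔸] [NormedAlgebra ℂ 𝔸] [CompleteSpace 𝔸]

/-! ## §1 One pair of constants for all truncations of a fixed shape -/

set_option maxHeartbeats 400000 in
-- induction with two long statement instances combined by `min`∕`max`; twice the default budget, no heavy automation
/-- **ALL TRUNCATIONS `1 ≤ m ≤ k` OF ONE SHAPE SHARE A PAIR OF CONSTANTS** (finite minimum ∕ maximum over `m` of file (U)'s per-`(k, m)` constants; `G`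
averaging-closed, `2 ≤ L ≤ ρ`).  Induction on a truncation bound. [cite: Balaban1985RegularSpaces, (1.59) p.86, (1.62) p.87, p.77; Balaban1985BackgroundPropagators, Thm 3.3 p.399] -/
theorem exists_curved159_perCube_touching_truncations_uniform [FiniteDimensional ℂ 𝔸] (hd2 : 2 ≤ d) {L : ℕ} (hL2 : 2 ≤ L)
    {G : Subgroup 𝔸ˣ} (hG : AvgClosed d L G) (M : ℕ) {ρ : ℕ} (hρ : L ≤ ρ) (k : ℕ) :
    ∀ mb : ℕ, ∃ α₀ B'' : ℝ, 0 < α₀ ∧ 0 < B'' ∧ ∀ m : ℕ, 1 ≤ m → m ≤ k → m ≤ mb →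
      ∀ (a : Site d) (η : ℝ), 0 < η → ∀ (U₀ : Site d → Fin d → 𝔸ˣ), (∀ x κ, U₀ x κ ∈ G) →
      (∀ (z : Site d) (κ μ : Fin d), κ ≠ μ → PlaqTouches (cubeFam false L a M ρ k 0) z κ μ → ‖plaqF U₀ κ μ z - 1‖ ≤ α₀) →
      ∀ φ : Site d → Fin d → 𝔸,
        IsLandau138 L m η (cubeFam false L a M ρ k 0) (cubeLamS L a M ρ k m) U₀ φ →
        (∀ (y : Site d) (τ : Fin d), (∀ j, j ≤ m → ¬ SideTouches (cubeFam false L a M ρ k j) y τ) → φ y τ = 0) →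
        ∀ N : ℝ, 0 ≤ N →
          (∀ j, j ≤ m → ∀ (y : Site d) (τ : Fin d), BondTouches (cubeFam false L a M ρ k j) y τ →
              ((L : ℝ) ^ j * η) ^ 3 * ‖Jcur η U₀ φ τ y‖ ≤ N) →
          (∀ j, j ≤ m → ∀ c ∈ cubeLamBP L a M ρ k m j, ‖linCovIter L U₀ (iEta η φ) j c.1 c.2‖ ≤ N) →
          (∀ (y : Site d) (τ : Fin d), ¬ BondTouches (cubeFam false L a M ρ k 0) y τ → η * ‖φ y τ‖ ≤ N) →
          ∀ j, j ≤ m → ∀ (y : Site d) (τ : Fin d), SideTouches (cubeFam false L a M ρ k j) y τ →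
            ((L : ℝ) ^ j * η) * ‖φ y τ‖ ≤ B'' * N ∧
            (∀ ν : Fin d, ((L : ℝ) ^ j * η) ^ 2 * ‖covDerivFwd η U₀ ν (fun z => φ z τ) y‖ ≤ B'' * N) ∧
            ((L : ℝ) ^ j * η) ^ 3 * ‖covLap η U₀ (fun z => φ z τ) y‖ ≤ B'' * N
  | 0 => ⟨1, 1, one_pos, one_pos, fun m h1 _ h0 => by omega⟩
  | mb + 1 => by
    obtain ⟨α₁, B₁, hα₁, hB₁, H₁⟩ := exists_curved159_perCube_touching_truncations_uniform hd2 hL2 hG M hρ k mb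
    by_cases hk : mb + 1 ≤ k
    · obtain ⟨α₂, B₂, hα₂, hB₂, H₂⟩ :=
        exists_curved159_perCube_touching_tower_uniform (𝔸 := 𝔸) hd2 hL2 hG M hρ (show 1 ≤ mb + 1 by omega) hk
      refine ⟨min α₁ α₂, max B₁ B₂, lt_min hα₁ hα₂, lt_max_of_lt_left hB₁, ?_⟩
      intro m h1 hmk hmb a η hη U₀ hU hP φ hLan hs N hN hJ hQ hO j hj y τ hst
      rcases Nat.lt_or_ge m (mb + 1) with hlt | hge
      · obtain ⟨t1, t2, t3⟩ := H₁ m h1 hmk (by omega) a η hη U₀ hU (fun z κ μ hκμ hpt => (hP z κ μ hκμ hpt).trans (min_le_left _ _))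
          φ hLan hs N hN hJ hQ hO j hj y τ hst
        exact ⟨t1.trans (mul_le_mul_of_nonneg_right (le_max_left _ _) hN),
          fun ν => (t2 ν).trans (mul_le_mul_of_nonneg_right (le_max_left _ _) hN),
          t3.trans (mul_le_mul_of_nonneg_right (le_max_left _ _) hN)⟩
      · have hm : m = mb + 1 := le_antisymm hmb hge
        subst hm
        obtain ⟨t1, t2, t3⟩ := H₂ a η hη U₀ hU (fun z κ μ hκμ hpt => (hP z κ μ hκμ hpt).trans (min_le_right _ _))
          φ hLan hs N hN hJ hQ hO j hj y τ hst
        exact ⟨t1.trans (mul_le_mul_of_nonneg_right (le_max_right _ _) hN),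
          fun ν => (t2 ν).trans (mul_le_mul_of_nonneg_right (le_max_right _ _) hN),
          t3.trans (mul_le_mul_of_nonneg_right (le_max_right _ _) hN)⟩
    · refine ⟨α₁, B₁, hα₁, hB₁, fun m h1 hmk _ => H₁ m h1 hmk (by omega)⟩

/-! ## §2 One pair of constants for all shapes of bounded depth -/

set_option maxHeartbeats 400000 in
-- induction with two long statement instances combined by `min`∕`max`; twice the default budget, no heavy automation
/-- ★★ **ALL CUBE MEMBERS OF DEPTH `≤ K` AND ALL TRUNCATIONS SHARE A PAIR OF CONSTANTS — WHICH DEPENDS ON `K`.**  For `d ≥ 2`, `2 ≤ L ≤ ρ`, a size `M`, an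
averaging-closed `G` and a depth bound `K` there are `α₀(K), B″(K) > 0` such that for every shape `1 ≤ m ≤ k ≤ K`, every position `a`, every spacing `η > 0` and
every `G`-valued `U₀` whose plaquettes touching `□₀` are `α₀`-small, the (1.59) triple at truncation `m` holds with constant `B″`.  PROOF: induction on `K`, §1 at
the top depth.  HONEST SCOPE in the module docstring: a finite maximum — NOT print's `K`-independent `B₀(d, L)`, NOT [4] Thm 3.3.
[cite: Balaban1985RegularSpaces, (1.59) p.86, (1.62) p.87, p.77, (1.131) p.99; Balaban1985Averaging, Prop. 2 (52)–(54) p.26; Balaban1985BackgroundPropagators, Thm 3.3 p.399] -/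
theorem exists_curved159_perCube_touching_depth_uniform [FiniteDimensional ℂ 𝔸] (hd2 : 2 ≤ d) {L : ℕ} (hL2 : 2 ≤ L)
    {G : Subgroup 𝔸ˣ} (hG : AvgClosed d L G) (M : ℕ) {ρ : ℕ} (hρ : L ≤ ρ) :
    ∀ K : ℕ, ∃ α₀ B'' : ℝ, 0 < α₀ ∧ 0 < B'' ∧ ∀ k m : ℕ, 1 ≤ m → m ≤ k → k ≤ K →
      ∀ (a : Site d) (η : ℝ), 0 < η → ∀ (U₀ : Site d → Fin d → 𝔸ˣ), (∀ x κ, U₀ x κ ∈ G) →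
      (∀ (z : Site d) (κ μ : Fin d), κ ≠ μ → PlaqTouches (cubeFam false L a M ρ k 0) z κ μ → ‖plaqF U₀ κ μ z - 1‖ ≤ α₀) →
      ∀ φ : Site d → Fin d → 𝔸,
        IsLandau138 L m η (cubeFam false L a M ρ k 0) (cubeLamS L a M ρ k m) U₀ φ →
        (∀ (y : Site d) (τ : Fin d), (∀ j, j ≤ m → ¬ SideTouches (cubeFam false L a M ρ k j) y τ) → φ y τ = 0) →
        ∀ N : ℝ, 0 ≤ N →
          (∀ j, j ≤ m → ∀ (y : Site d) (τ : Fin d), BondTouches (cubeFam false L a M ρ k j) y τ →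
              ((L : ℝ) ^ j * η) ^ 3 * ‖Jcur η U₀ φ τ y‖ ≤ N) →
          (∀ j, j ≤ m → ∀ c ∈ cubeLamBP L a M ρ k m j, ‖linCovIter L U₀ (iEta η φ) j c.1 c.2‖ ≤ N) →
          (∀ (y : Site d) (τ : Fin d), ¬ BondTouches (cubeFam false L a M ρ k 0) y τ → η * ‖φ y τ‖ ≤ N) →
          ∀ j, j ≤ m → ∀ (y : Site d) (τ : Fin d), SideTouches (cubeFam false L a M ρ k j) y τ →
            ((L : ℝ) ^ j * η) * ‖φ y τ‖ ≤ B'' * N ∧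
            (∀ ν : Fin d, ((L : ℝ) ^ j * η) ^ 2 * ‖covDerivFwd η U₀ ν (fun z => φ z τ) y‖ ≤ B'' * N) ∧
            ((L : ℝ) ^ j * η) ^ 3 * ‖covLap η U₀ (fun z => φ z τ) y‖ ≤ B'' * N
  | 0 => ⟨1, 1, one_pos, one_pos, fun k m h1 hmk hk0 => by omega⟩
  | K + 1 => by
    obtain ⟨α₁, B₁, hα₁, hB₁, H₁⟩ := exists_curved159_perCube_touching_depth_uniform hd2 hL2 hG M hρ K
    obtain ⟨α₂, B₂, hα₂, hB₂, H₂⟩ := exists_curved159_perCube_touching_truncations_uniform (𝔸 := 𝔸) hd2 hL2 hG M hρ (K + 1) (K + 1)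
    refine ⟨min α₁ α₂, max B₁ B₂, lt_min hα₁ hα₂, lt_max_of_lt_left hB₁, ?_⟩
    intro k m h1 hmk hkK a η hη U₀ hU hP φ hLan hs N hN hJ hQ hO j hj y τ hst
    rcases Nat.lt_or_ge k (K + 1) with hlt | hge
    · obtain ⟨t1, t2, t3⟩ := H₁ k m h1 hmk (by omega) a η hη U₀ hU (fun z κ μ hκμ hpt => (hP z κ μ hκμ hpt).trans (min_le_left _ _))
        φ hLan hs N hN hJ hQ hO j hj y τ hst
      exact ⟨t1.trans (mul_le_mul_of_nonneg_right (le_max_left _ _) hN),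
        fun ν => (t2 ν).trans (mul_le_mul_of_nonneg_right (le_max_left _ _) hN),
        t3.trans (mul_le_mul_of_nonneg_right (le_max_left _ _) hN)⟩
    · have hk : k = K + 1 := le_antisymm hkK hge
      subst hk
      obtain ⟨t1, t2, t3⟩ := H₂ m h1 hmk hmk a η hη U₀ hU (fun z κ μ hκμ hpt => (hP z κ μ hκμ hpt).trans (min_le_right _ _))
        φ hLan hs N hN hJ hQ hO j hj y τ hst
      exact ⟨t1.trans (mul_le_mul_of_nonneg_right (le_max_right _ _) hN),
        fun ν => (t2 ν).trans (mul_le_mul_of_nonneg_right (le_max_right _ _) hN),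
        t3.trans (mul_le_mul_of_nonneg_right (le_max_right _ _) hN)⟩

/-! ## §3 Unitary C⋆ backgrounds, any domain sequence with `□₀ ⊆ Ω₀`, `InAk` form -/

/-- ★★ **ONE `(α₀, B″)` FOR EVERY CUBE MEMBER OF DEPTH `≤ K` OF ONE PROGRAMME — unitary C⋆ backgrounds, `InAk` on any `{Ω_j}` with `□₀ ⊆ Ω₀`.**  For every
`K` there are `α₀(K), B″(K) > 0` such that for all `1 ≤ m ≤ k ≤ K`, all `a`, `η > 0`, every unitary `U₀`, every `{Ω_j}`, `k′` with `□₀(a) ⊆ Ω₀` and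
`U₀ ∈ 𝔄_{k′}({Ω_j}, α₀)`, the (1.59) triple at truncation `m` holds with `B″`.  HONEST SCOPE: `K`-DEPENDENT finite maximum; NOT [4] Thm 3.3's `B₀(d, L)`; claims no
socket. [cite: Balaban1985RegularSpaces, (1.59) p.86, (1.7) p.77, p.99 («□_j ⊂ Ω_j»); Balaban1985Averaging, (42)–(43) pp.23–24; Balaban1985BackgroundPropagators, Thm 3.3 p.399] -/
theorem exists_curved159_perCube_inAk_sup_unitary_depth_uniform {𝔹 : Type*} [CStarAlgebra 𝔹] [Nontrivial 𝔹] [FiniteDimensional ℂ 𝔹]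
    (hd2 : 2 ≤ d) {L : ℕ} (hL2 : 2 ≤ L) (M : ℕ) {ρ : ℕ} (hρ : L ≤ ρ) (K : ℕ) :
    ∃ α₀ B'' : ℝ, 0 < α₀ ∧ 0 < B'' ∧ ∀ k m : ℕ, 1 ≤ m → m ≤ k → k ≤ K →
      ∀ (a : Site d) (η : ℝ), 0 < η → ∀ (U₀ : Site d → Fin d → 𝔹ˣ), (∀ x κ, U₀ x κ ∈ unitaryUnits 𝔹) →
      ∀ (Ω : ℕ → Set (Site d)) (k' : ℕ), cubeFam false L a M ρ k 0 ⊆ Ω 0 → InAk L k' η α₀ Ω U₀ →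
      ∀ φ : Site d → Fin d → 𝔹,
        IsLandau138 L m η (cubeFam false L a M ρ k 0) (cubeLamS L a M ρ k m) U₀ φ →
        (∀ (y : Site d) (τ : Fin d), (∀ j, j ≤ m → ¬ SideTouches (cubeFam false L a M ρ k j) y τ) → φ y τ = 0) →
        ∀ N : ℝ, 0 ≤ N →
          (∀ j, j ≤ m → ∀ (y : Site d) (τ : Fin d), BondTouches (cubeFam false L a M ρ k j) y τ →
              ((L : ℝ) ^ j * η) ^ 3 * ‖Jcur η U₀ φ τ y‖ ≤ N) →
          (∀ j, j ≤ m → ∀ c ∈ cubeLamBP L a M ρ k m j, ‖linCovIter L U₀ (iEta η φ) j c.1 c.2‖ ≤ N) →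
          (∀ (y : Site d) (τ : Fin d), ¬ BondTouches (cubeFam false L a M ρ k 0) y τ → η * ‖φ y τ‖ ≤ N) →
          ∀ j, j ≤ m → ∀ (y : Site d) (τ : Fin d), SideTouches (cubeFam false L a M ρ k j) y τ →
            ((L : ℝ) ^ j * η) * ‖φ y τ‖ ≤ B'' * N ∧
            (∀ ν : Fin d, ((L : ℝ) ^ j * η) ^ 2 * ‖covDerivFwd η U₀ ν (fun z => φ z τ) y‖ ≤ B'' * N) ∧
            ((L : ℝ) ^ j * η) ^ 3 * ‖covLap η U₀ (fun z => φ z τ) y‖ ≤ B'' * N := by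
  obtain ⟨α₀, B'', hα₀, hB'', H⟩ :=
    exists_curved159_perCube_touching_depth_uniform (𝔸 := 𝔹) hd2 hL2 (avgClosed_unitaryUnits d L) M hρ K
  refine ⟨α₀, B'', hα₀, hB'', fun k m h1 hmk hkK a η hη U₀ hU Ω k' hΩ hAk =>
    H k m h1 hmk hkK a η hη U₀ hU fun z κ μ hκμ hpt => ?_⟩
  have h := (B8Ineq132.condAt_anti hΩ (hAk 0 (Nat.zero_le _))).1 z κ μ hκμ hpt
  simp only [pow_zero, inv_one, one_pow, mul_one] at h
  exact h.le

end Literature.MathematicalPhysics.QuantumFieldTheory.Balaban1983to89.B8Ineq159CurvedCubeMemberDepthUniform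

end
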